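import Summits.AtomisticToContinuum.Crystallization.Theorems.FrustratedLawDichotomyCellF1Row
import Summits.AtomisticToContinuum.Crystallization.Theorems.FrustratedLawDichotomyCellRows
import Summits.AtomisticToContinuum.Crystallization.Theorems.FrustratedLawDichotomyCellGridFree

/-!
# FrustratedLawDichotomy · crux `AperiodicFrustratedLawGap` (stmt-AtomisticToContinuum-27623) — class-A K-file skeleton, layer 4b:
the F1 ROW OF RECORD `KF1` — measurability, floor-from-certificate, and the orientation-free cover (decomp-a2c hand-2 g47, structural share;
KFILE-FORMAT ed2 §2 steps 7–8: «ROW `K := ⋃_{F ∈ ratBox B} coherentAt …`; hK := (262) `measurableSet_ratRow`; hfloor := (262) `rowFloor_rat`;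
COVER (264) `row_cover_nearId` at (ε_cov, τ_cov, η, A)»)

The (228) atlas consumes, per cell, a measurable set `K` of configurations and a floor `hfloor` on it.  For F1: `KF1 := ⋃_{F ∈ ratBox BF1}
coherentAt (MF1.image (posL F ∘ aF1)) τ Rc` (rational matrices of the strain cell — countable union ⇒ measurable: `measurableSet_KF1`); ★
`hfloor_KF1` — GIVEN the K-certificate `hcert` of the Floor file, every rooted `7/10`-hard-core NASH configuration in `KF1` has root energy
`≥ c + mc` (layer 4 `row_F1` ∘ (262) `rowFloor_rat`); and ★ `cover_KF1` — T4's side: every configuration coherent at radius `τ_cov = 511/524288`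
with ANY real `F` of the slightly smaller box `nearIdBox ε_cov`, `ε_cov = 4095/4194304`, lies in `KF1` ((264) `row_cover_nearId` with `η = 2⁻²⁵`,
`A = 13`: `‖aF1 m‖ ≤ 13` on `MF1` from layer 2e at `F = 1`).  So the F1 cell's contribution to the atlas is reduced to the single inequality `hcert`.
-/

namespace Summit.AtomisticToContinuum.Crystallization.Theorems.FrustratedLawDichotomyCellF1RowSet

open MeasureTheory
open scoped BigOperators
open Literature.MathematicalPhysics.StatisticalMechanics (lennardJones rootEnergy)
open Literature.Probability.Process (IsRootedHardCore)
open Summit.AtomisticToContinuum.Crystallization.Theorems.ChargedEnergyGapNegative (E3)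
open Summit.AtomisticToContinuum.Crystallization.Theorems.FrustratedLawDichotomyCoherentSets (coherentAt)
open Summit.AtomisticToContinuum.Crystallization.Theorems.FrustratedLawDichotomyCellFrame (certFloorL)
open Summit.AtomisticToContinuum.Crystallization.Theorems.FrustratedLawDichotomyCellMetric (posL)
open Summit.AtomisticToContinuum.Crystallization.Theorems.FrustratedLawDichotomyCellRows (ratBox measurableSet_ratRow rowFloor_rat)
open Summit.AtomisticToContinuum.Crystallization.Theorems.FrustratedLawDichotomyCellGridFree (nearIdBox row_cover_nearId epsCov_le)
open Summit.AtomisticToContinuum.Crystallization.Theorems.FrustratedLawDichotomyCellF1Labels (MF1 MIF1)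
open Summit.AtomisticToContinuum.Crystallization.Theorems.FrustratedLawDichotomyCellF1Symm (BF1)
open Summit.AtomisticToContinuum.Crystallization.Theorems.FrustratedLawDichotomyCellF1Pos (aF1 norm_M_le_aF1)
open Summit.AtomisticToContinuum.Crystallization.Theorems.FrustratedLawDichotomyCellF1Row (row_F1)

/-- ★ the F1 ROW OF RECORD: configurations coherent (radius `τ = 2⁻¹⁰`, window `Rc = 13`) at the strained template `posL F ∘ aF1` for some RATIONAL
`F` of the strain cell `BF1`. -/
def KF1 : Set (Measure E3) := ⋃ F ∈ ratBox BF1, coherentAt (MF1.image fun m => posL F (aF1 m)) (1 / 1024) 13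

/-- unfolding. -/
theorem KF1_eq : KF1 = ⋃ F ∈ ratBox BF1, coherentAt (MF1.image fun m => posL F (aF1 m)) (1 / 1024) 13 := rfl

/-- ★ (hK) the F1 row is measurable (countable union over rational matrices, (262)). -/
theorem measurableSet_KF1 : MeasurableSet KF1 := measurableSet_ratRow BF1 MF1 (fun F m => posL F (aF1 m)) (1 / 1024) 13

/-- the row sits inside the real-`F` row of layer 4. -/
theorem KF1_subset : KF1 ⊆ ⋃ F ∈ BF1, coherentAt (MF1.image fun m => posL F (aF1 m)) (1 / 1024) 13 :=
  Set.biUnion_subset_biUnion_left (Set.inter_subset_left)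

/-- ★★ (hfloor) THE F1 FLOOR ON THE ROW OF RECORD, modulo the K-certificate: for any multiplier placement `YF` and constants with `c ≤ cUp` and
`2·(cUp + mc) ≤ certFloorL …` over the strain cell, every rooted `7/10`-hard-core NASH configuration in `KF1` has root energy `≥ c + mc`. -/
theorem hfloor_KF1 (YF : Matrix (Fin 3) (Fin 3) ℝ → ℤ × ℤ × ℤ → E3) {c mc cUp : ℝ} (hc : c ≤ cUp)
    (hcert : ∀ F ∈ BF1, 2 * (cUp + mc) ≤ certFloorL MF1 MIF1 0 (fun m => posL F (aF1 m)) (YF F) (1 / 1024) 13) :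
    ∀ μ : Measure E3, IsRootedHardCore (7 / 10) μ →
      (∀ p : E3, μ {p} ≠ 0 → ∀ w : E3, (∀ q : E3, μ {q} ≠ 0 → q ≠ p → w ≠ q) →
        ∑' q : {q : E3 // μ {q} ≠ 0 ∧ q ≠ p}, lennardJones (dist p (q : E3)) ≤
          ∑' q : {q : E3 // μ {q} ≠ 0 ∧ q ≠ p}, lennardJones (dist w (q : E3))) →
      μ ∈ KF1 → c + mc ≤ rootEnergy lennardJones μ :=
  fun μ hμ hNash hrow => row_F1 YF hc hcert μ hμ hNash (KF1_subset hrow)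

/-- `‖aF1 m‖ ≤ 13` on `MF1` at the identity placement (the `A` of the cover lemma). -/
theorem norm_aF1_le : ∀ m ∈ MF1, ‖posL 1 (aF1 m)‖ ≤ 13 := by
  intro m hm
  have h1 : (1 : Matrix (Fin 3) (Fin 3) ℝ) ∈ BF1 := by
    intro i j
    rw [Matrix.transpose_one, Matrix.mul_one, Matrix.one_apply, sub_self, abs_zero]
    norm_num
  linarith [norm_M_le_aF1 h1 m hm]

/-- ★ (COVER, T4's side) every configuration coherent at radius `τ_cov = 511/524288` with ANY real `F ∈ nearIdBox (4095/4194304)` at the strained F1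
template lies in the row of record `KF1` ((264) with `η = 2⁻²⁵`, `A = 13`). -/
theorem cover_KF1 : (⋃ F ∈ nearIdBox (4095 / 4194304), coherentAt (MF1.image fun m => posL F (aF1 m)) (511 / 524288) 13) ⊆ KF1 := by
  have h := row_cover_nearId MF1 aF1 (εc := 4095 / 4194304) (ε := 1 / 1024) (τc := 511 / 524288) (τr := 1 / 1024) (η := 1 / 33554432)
    (A := 13) 13 (by norm_num) (by norm_num) norm_aF1_le (by norm_num) epsCov_le
  intro μ hμ
  have hμ' := h hμ
  -- `ratBox (nearIdBox (1/1024)) = ratBox BF1` definitionally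
  exact hμ'


/-! ## §2 (appended, hand-2 g47) The named placement column and the certificate interface in rule-G5 shape -/

/-- ★ the F1 PLACEMENT column, NAMED (rule G5, TOY 9's `pos9`): `posF1 F m = posL F (aF1 m)`. -/
noncomputable def posF1 (F : Matrix (Fin 3) (Fin 3) ℝ) (m : ℤ × ℤ × ℤ) : E3 := posL F (aF1 m)

/-- unfolding (definitional). -/
theorem posF1_eq (F : Matrix (Fin 3) (Fin 3) ℝ) (m : ℤ × ℤ × ℤ) : posF1 F m = posL F (aF1 m) := rfl

/-- the K-CERTIFICATE INTERFACE of the F1 cell: what the Floor file proves, for a named multiplier placement `YF` and constants `cUp`, `mc` —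
`2·(cUp + mc) ≤ certFloorL MF1 MIF1 0 (posF1 F) (YF F) τ Rc` for every `F ∈ BF1` (ONE application of hand-1's `lb_le_certFloorL_scale` with
named columns + ONE decided inequality). -/
def CertF1 (YF : Matrix (Fin 3) (Fin 3) ℝ → ℤ × ℤ × ℤ → E3) (cUp mc : ℝ) : Prop :=
  ∀ F ∈ BF1, 2 * (cUp + mc) ≤ certFloorL MF1 MIF1 0 (posF1 F) (YF F) (1 / 1024) 13

/-- ★★ (hfloor, named form) from the certificate interface: every rooted `7/10`-hard-core NASH configuration of the F1 row of record has root energy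
`≥ c + mc` whenever `c ≤ cUp` and `CertF1 YF cUp mc`. -/
theorem hfloor_KF1_of_cert {YF : Matrix (Fin 3) (Fin 3) ℝ → ℤ × ℤ × ℤ → E3} {c mc cUp : ℝ} (hc : c ≤ cUp) (hcert : CertF1 YF cUp mc) :
    ∀ μ : Measure E3, IsRootedHardCore (7 / 10) μ →
      (∀ p : E3, μ {p} ≠ 0 → ∀ w : E3, (∀ q : E3, μ {q} ≠ 0 → q ≠ p → w ≠ q) →
        ∑' q : {q : E3 // μ {q} ≠ 0 ∧ q ≠ p}, lennardJones (dist p (q : E3)) ≤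
          ∑' q : {q : E3 // μ {q} ≠ 0 ∧ q ≠ p}, lennardJones (dist w (q : E3))) →
      μ ∈ KF1 → c + mc ≤ rootEnergy lennardJones μ :=
  hfloor_KF1 YF hc hcert

end Summit.AtomisticToContinuum.Crystallization.Theorems.FrustratedLawDichotomyCellF1RowSet
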